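import Mathlib.RingTheory.Length
import Mathlib.LinearAlgebra.Quotient.Basic
import HarnessLib

/-!
# Route `RadicialJung`, crux `CleanModels` (stmt-15917): lengths of subquotients `N/D`

Support file (OURS; general module theory) for PROGRAMME-clean-dim2 of the crux
`RadicialJung.CleanModels` (stmt-15917; line `via-clean-models` of `DescentPerfectToAll`, W8.1): the
length bookkeeping behind Giraud's Lemme 2.1.1 (`RadicialJungCleanModelsGiraudTotalColength.lean`).
For submodules `D ≤ N` of an `R`-module `V` we write `N/D` for the subquotient
`↥N ⧸ D.comap N.subtype` and `λ` for `Module.length R` (values in `ℕ∞`). PROVED, no definitions: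

* `length_quot_add_length_quot_eq_inf_add_sup` — **for two nested pairs `D_A ≤ N_A`, `D_B ≤ N_B`:
  `λ(N_A/D_A) + λ(N_B/D_B) = λ((N_A ⊓ N_B)/(D_A ⊓ D_B)) + λ((N_A + N_B)/(D_A + D_B))`.**
  The difference map `N_A/D_A ⊕ N_B/D_B → (N_A + N_B)/(D_A + D_B)` is surjective with kernel the
  diagonal image of `N_A ⊓ N_B`, whose kernel in turn is `D_A ⊓ D_B`; length is additive. This
  is the algebraic skeleton of the Čech computation of the global sections of a quotient sheaf
  `𝒩/𝒟` on a scheme covered by two affine opens (used for the two charts of the blowing up of a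
  closed point of a regular surface: `RadicialJungCleanModelsGiraudTotalColength.lean`).
* `length_quot_comap_le_of_le` — `λ(N/D) ≤ λ(N/D₀)` for `D₀ ≤ D`;
* `length_quot_comap_add_length_quotient` — `λ(N/J) + λ(V/N) = λ(V/J)` for `J ≤ N`;
* `length_quot_comap_map_eq` — `λ(φ(N)/φ(J)) = λ(N/J)` along an injective linear map `φ`.

## References
* [HunekeSwanson2006] C. Huneke, I. Swanson, *Integral Closure of Ideals, Rings, and Modules*,
  CUP 2006, §14.3 (length bookkeeping for transforms of ideals) — context only; the lemmas are
  folklore module theory. Nothing here is a statement of Hironaka's manuscript or bears on the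
  summit. [folklore]
-/

noncomputable section

set_option linter.dupNamespace false -- mandated namespace of this single-conjunct summit

namespace Summit.ResolutionOfSingularities.ResolutionOfSingularities.Theorems.RadicialJung.CleanModels

universe u v

/-! ## A length identity for two pairs of nested submodules -/

section Lattice

variable {R : Type u} [Ring R] {V : Type v} [AddCommGroup V] [Module R V]

/-- **Length identity for two nested pairs of submodules.** For submodules `D_A ≤ N_A` and
`D_B ≤ N_B` of a module `V`,
`λ(N_A/D_A) + λ(N_B/D_B) = λ((N_A ⊓ N_B)/(D_A ⊓ D_B)) + λ((N_A + N_B)/(D_A + D_B))`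
(lengths in `ℕ∞`; `N/D` stands for the quotient of `N` by the trace of `D`): the difference map
`N_A/D_A ⊕ N_B/D_B → (N_A + N_B)/(D_A + D_B)` is surjective and its kernel is the diagonal image
of `N_A ⊓ N_B`, with kernel `D_A ⊓ D_B`. This is the algebraic skeleton of the Čech computation
of `H⁰` of a skyscraper quotient sheaf on a scheme covered by two affine opens. [folklore] -/
theorem length_quot_add_length_quot_eq_inf_add_sup {NA NB DA DB NI DI NS DS : Submodule R V}
    (hA : DA ≤ NA) (hB : DB ≤ NB) (hNI : NA ⊓ NB = NI) (hDI : DA ⊓ DB = DI)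
    (hNS : NA ⊔ NB = NS) (hDS : DA ⊔ DB = DS) :
    Module.length R (↥NA ⧸ DA.comap NA.subtype) + Module.length R (↥NB ⧸ DB.comap NB.subtype) =
      Module.length R (↥NI ⧸ DI.comap NI.subtype) +
        Module.length R (↥NS ⧸ DS.comap NS.subtype) := by
  subst hNI hDI hNS hDS
  -- the diagonal `ι : (NA ⊓ NB)/(DA ⊓ DB) → NA/DA × NB/DB`
  let ιA : ↥(NA ⊓ NB) ⧸ (DA ⊓ DB).comap (NA ⊓ NB).subtype →ₗ[R] ↥NA ⧸ DA.comap NA.subtype :=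
    Submodule.mapQ _ _ (Submodule.inclusion inf_le_left) (by
      intro g hg
      simp only [Submodule.mem_comap, Submodule.subtype_apply, Submodule.coe_inclusion] at hg ⊢
      exact hg.1)
  let ιB : ↥(NA ⊓ NB) ⧸ (DA ⊓ DB).comap (NA ⊓ NB).subtype →ₗ[R] ↥NB ⧸ DB.comap NB.subtype :=
    Submodule.mapQ _ _ (Submodule.inclusion inf_le_right) (by
      intro g hg
      simp only [Submodule.mem_comap, Submodule.subtype_apply, Submodule.coe_inclusion] at hg ⊢
      exact hg.2)
  let ι := LinearMap.prod ιA ιB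
  have hι_mk : ∀ g : ↥(NA ⊓ NB), ι (Submodule.Quotient.mk g) =
      (Submodule.Quotient.mk (Submodule.inclusion inf_le_left g),
        Submodule.Quotient.mk (Submodule.inclusion inf_le_right g)) := fun _ => rfl
  -- the difference map `ψ : NA/DA × NB/DB → (NA ⊔ NB)/(DA ⊔ DB)`
  let ψA : (↥NA ⧸ DA.comap NA.subtype) →ₗ[R] ↥(NA ⊔ NB) ⧸ (DA ⊔ DB).comap (NA ⊔ NB).subtype :=
    Submodule.mapQ _ _ (Submodule.inclusion le_sup_left) (by
      intro a ha
      simp only [Submodule.mem_comap, Submodule.subtype_apply, Submodule.coe_inclusion] at ha ⊢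
      exact Submodule.mem_sup_left ha)
  let ψB : (↥NB ⧸ DB.comap NB.subtype) →ₗ[R] ↥(NA ⊔ NB) ⧸ (DA ⊔ DB).comap (NA ⊔ NB).subtype :=
    Submodule.mapQ _ _ (Submodule.inclusion le_sup_right) (by
      intro b hb
      simp only [Submodule.mem_comap, Submodule.subtype_apply, Submodule.coe_inclusion] at hb ⊢
      exact Submodule.mem_sup_right hb)
  let ψ := LinearMap.coprod ψA (-ψB)
  have hψ : ∀ (a : NA) (b : NB), ψ (Submodule.Quotient.mk a, Submodule.Quotient.mk b) =
      Submodule.Quotient.mk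
        (Submodule.inclusion le_sup_left a - Submodule.inclusion le_sup_right b) := by
    intro a b
    change ψA (Submodule.Quotient.mk a) + -(ψB (Submodule.Quotient.mk b)) = _
    simp only [ψA, ψB, Submodule.mapQ_apply]
    rw [← Submodule.Quotient.mk_neg, ← Submodule.Quotient.mk_add, ← sub_eq_add_neg]
  -- `ι` is injective
  have hι : Function.Injective ι := by
    rw [← LinearMap.ker_eq_bot, eq_bot_iff]
    intro q hq
    induction q using Submodule.Quotient.induction_on with
    | H g =>
      rw [LinearMap.mem_ker, hι_mk, Prod.mk_eq_zero, Submodule.Quotient.mk_eq_zero,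
        Submodule.Quotient.mk_eq_zero, Submodule.mem_comap, Submodule.mem_comap,
        Submodule.subtype_apply, Submodule.subtype_apply, Submodule.coe_inclusion,
        Submodule.coe_inclusion] at hq
      rw [Submodule.mem_bot, Submodule.Quotient.mk_eq_zero, Submodule.mem_comap]
      exact ⟨hq.1, hq.2⟩
  -- `ψ` is surjective
  have hψs : Function.Surjective ψ := by
    intro q
    induction q using Submodule.Quotient.induction_on with
    | H c =>
      obtain ⟨a, ha, b, hb, hab⟩ := Submodule.mem_sup.mp c.2
      refine ⟨(Submodule.Quotient.mk ⟨a, ha⟩, Submodule.Quotient.mk ⟨-b, neg_mem hb⟩), ?_⟩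
      rw [hψ]
      congr 1
      apply Subtype.ext
      simp only [Submodule.coe_sub, Submodule.coe_inclusion, sub_neg_eq_add, hab]
  -- exactness in the middle
  have hex : Function.Exact ι ψ := by
    intro q
    constructor
    · intro hq
      obtain ⟨qa, qb⟩ := q
      induction qa using Submodule.Quotient.induction_on with
      | H a =>
        induction qb using Submodule.Quotient.induction_on with
        | H b =>
          rw [hψ, Submodule.Quotient.mk_eq_zero, Submodule.mem_comap, Submodule.subtype_apply,
            Submodule.coe_sub, Submodule.coe_inclusion, Submodule.coe_inclusion,
            Submodule.mem_sup] at hq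
          obtain ⟨d₁, hd₁, d₂, hd₂, hd⟩ := hq
          -- `g = a - d₁ = b + d₂ ∈ NA ⊓ NB`
          have e : (a : V) - d₁ = b + d₂ := by
            calc (a : V) - d₁ = ((a : V) - b) - d₁ + b := by abel
              _ = (d₁ + d₂) - d₁ + b := by rw [hd]
              _ = b + d₂ := by abel
          have hgA : (a : V) - d₁ ∈ NA := sub_mem a.2 (hA hd₁)
          have hgB : (a : V) - d₁ ∈ NB := by
            rw [e]
            exact add_mem b.2 (hB hd₂)
          refine ⟨Submodule.Quotient.mk ⟨(a : V) - d₁, hgA, hgB⟩, ?_⟩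
          rw [hι_mk, Prod.mk.injEq]
          constructor
          · rw [Submodule.Quotient.eq, Submodule.mem_comap, Submodule.subtype_apply,
              Submodule.coe_sub, Submodule.coe_inclusion]
            show (a : V) - d₁ - a ∈ DA
            have e' : (a : V) - d₁ - a = -d₁ := by abel
            rw [e']
            exact neg_mem hd₁
          · rw [Submodule.Quotient.eq, Submodule.mem_comap, Submodule.subtype_apply,
              Submodule.coe_sub, Submodule.coe_inclusion]
            show (a : V) - d₁ - b ∈ DB
            rw [e, add_sub_cancel_left]
            exact hd₂
    · rintro ⟨q', rfl⟩
      induction q' using Submodule.Quotient.induction_on with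
      | H g =>
        rw [hι_mk, hψ, Submodule.Quotient.mk_eq_zero]
        have e : Submodule.inclusion le_sup_left (Submodule.inclusion inf_le_left g) -
            Submodule.inclusion le_sup_right (Submodule.inclusion inf_le_right g) =
            (0 : ↥(NA ⊔ NB)) := by
          apply Subtype.ext
          simp only [Submodule.coe_sub, Submodule.coe_inclusion, sub_self, Submodule.coe_zero]
        rw [e]
        exact zero_mem _
  rw [← Module.length_prod, Module.length_eq_add_of_exact ι ψ hι hψs hex]

end Lattice

/-! ## General quotient-length bookkeeping -/

section Quot

variable {R : Type u} [Ring R] {V : Type v} [AddCommGroup V] [Module R V]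

/-- Enlarging the submodule one divides by can only lower the length:
`λ(N/D) ≤ λ(N/D₀)` for `D₀ ≤ D`. [folklore] -/
theorem length_quot_comap_le_of_le (N : Submodule R V) {D₀ D : Submodule R V} (h : D₀ ≤ D) :
    Module.length R (↥N ⧸ D.comap N.subtype) ≤ Module.length R (↥N ⧸ D₀.comap N.subtype) :=
  Module.length_le_of_surjective (Submodule.factor (Submodule.comap_mono h))
    (Submodule.factor_surjective _)

/-- `λ(N/J) + λ(V/N) = λ(V/J)` for submodules `J ≤ N` of `V` (exact sequence
`0 → N/J → V/J → V/N → 0`). [folklore] -/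
theorem length_quot_comap_add_length_quotient {J N : Submodule R V} (h : J ≤ N) :
    Module.length R (↥N ⧸ J.comap N.subtype) + Module.length R (V ⧸ N) =
      Module.length R (V ⧸ J) := by
  let f : (↥N ⧸ J.comap N.subtype) →ₗ[R] V ⧸ J := Submodule.mapQ _ _ N.subtype le_rfl
  let g : (V ⧸ J) →ₗ[R] V ⧸ N := Submodule.factor h
  have hf : Function.Injective f := by
    rw [← LinearMap.ker_eq_bot, eq_bot_iff]
    intro q hq
    induction q using Submodule.Quotient.induction_on with
    | H n =>
      rw [LinearMap.mem_ker, Submodule.mapQ_apply, Submodule.Quotient.mk_eq_zero] at hq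
      rw [Submodule.mem_bot, Submodule.Quotient.mk_eq_zero, Submodule.mem_comap]
      exact hq
  have hg : Function.Surjective g := Submodule.factor_surjective h
  have hex : Function.Exact f g := by
    intro q
    induction q using Submodule.Quotient.induction_on with
    | H v =>
      change (Submodule.Quotient.mk v : V ⧸ N) = 0 ↔ _
      rw [Submodule.Quotient.mk_eq_zero]
      constructor
      · intro hv
        exact ⟨Submodule.Quotient.mk ⟨v, hv⟩, rfl⟩
      · rintro ⟨q, hq⟩
        induction q using Submodule.Quotient.induction_on with
        | H n =>
          rw [Submodule.mapQ_apply, Submodule.Quotient.eq, Submodule.subtype_apply] at hq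
          have : v = (n : V) - ((n : V) - v) := by abel
          rw [this]
          exact sub_mem n.2 (h hq)
  exact (Module.length_eq_add_of_exact f g hf hg hex).symm

/-- Transport of `N/J` along an injective linear map `φ`: `λ(φ(N)/φ(J)) = λ(N/J)` for `J ≤ N`.
[folklore] -/
theorem length_quot_comap_map_eq {W : Type*} [AddCommGroup W] [Module R W] (φ : V →ₗ[R] W)
    (hφ : Function.Injective φ) {J N : Submodule R V} (h : J ≤ N) :
    Module.length R (↥(N.map φ) ⧸ (J.map φ).comap (N.map φ).subtype) =
      Module.length R (↥N ⧸ J.comap N.subtype) := by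
  symm
  refine (Submodule.Quotient.equiv (J.comap N.subtype) ((J.map φ).comap (N.map φ).subtype)
    (Submodule.equivMapOfInjective φ hφ N) ?_).length_eq
  ext ⟨w, hw⟩
  simp only [Submodule.mem_map, Submodule.mem_comap, Submodule.subtype_apply]
  constructor
  · rintro ⟨⟨n, hn⟩, hnJ, hnw⟩
    refine ⟨n, hnJ, ?_⟩
    have := congrArg Subtype.val hnw
    simpa using this
  · rintro ⟨j, hj, hjw⟩
    refine ⟨⟨j, h hj⟩, hj, ?_⟩
    apply Subtype.ext
    simpa using hjw

end Quot

end Summit.ResolutionOfSingularities.ResolutionOfSingularities.Theorems.RadicialJung.CleanModels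

end
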